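import Mathlib
import HarnessLib

/-!
# HeathBrownLargeGapSum

Topic `Literature/NumberTheory/LFunctions`. Named literature fact(s) relocated by the gate from `Summits/RiemannHypothesis/RiemannHypothesis/Theorems/HandoffEdgeAlmostAll.lean`
(accept-time relocation of `[cite]`d propositions written inline in a Summits proposal; human ruling 2026-08-15).
Sources: HeathBrown2021DifferencesV.

* `Literature.NumberTheory.LFunctions.HeathBrown2021_sqrtGapSum`
-/

namespace Literature.NumberTheory.LFunctions

open Complex Filter Set MeasureTheory Literature.NumberTheory.LFunctions
open scoped Real Topology ComplexConjugate ContDiff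

/-- NAMED FACT — **Heath-Brown 2021, Theorem 1** (D. R. Heath-Brown, *The Differences Between Consecutive Primes, V*,
IMRN 2021 no. 22, 17514–17562 = arXiv:1906.09555, p. 1, as printed: «For any fixed `ε > 0` we have
`Σ_{p_n ≤ x, p_{n+1} − p_n ≥ √p_n} (p_{n+1} − p_n) ≪_ε x^{3/5+ε}`.»). Here `p_n = Nat.nth Nat.Prime n` (`p_0 = 2`); the
index range `n ≤ ⌊x⌋` is exhaustive because `p_n ≥ n + 2`; `≪_ε` is read as «for every `ε > 0` there is `C` with the bound
for all `x ≥ 2`» (for bounded `x` the sum is bounded, so this is the printed statement). A PROVED theorem in print; not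
proved in the tree. Users take `(h : HeathBrown2021_sqrtGapSum)`.
[cite: HeathBrown2021DifferencesV, Thm 1 (p. 1)] [file NumberTheory/LFunctions/HeathBrownLargeGapSum] -/
def HeathBrown2021_sqrtGapSum : Prop :=
  ∀ ε : ℝ, 0 < ε → ∃ C : ℝ, ∀ x : ℝ, 2 ≤ x →
    (∑ n ∈ (Finset.range (⌊x⌋₊ + 1)).filter (fun n ↦ (Nat.nth Nat.Prime n : ℝ) ≤ x ∧
        Real.sqrt (Nat.nth Nat.Prime n) ≤ (Nat.nth Nat.Prime (n + 1) : ℝ) - Nat.nth Nat.Prime n),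
      ((Nat.nth Nat.Prime (n + 1) : ℝ) - Nat.nth Nat.Prime n)) ≤ C * x ^ (3 / 5 + ε)

/-! ## §2 Consecutive `nth` primes and the edge block at a non-exceptional index -/

end Literature.NumberTheory.LFunctions
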